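import Summits.CriticalPhenomena.PercolationContinuityZ3.Theorems.Transplant.FKConnectivityAllQAntipodalAnd4Parallel
import Summits.CriticalPhenomena.PercolationContinuityZ3.Theorems.Transplant.FKConnectivityAllQAntipodalAnd4SeriesMain
import Summits.CriticalPhenomena.PercolationContinuityZ3.Theorems.Transplant.FKConnectivityAllQAntipodalMinorUpc
import HarnessLib

/-!
# Connectivity correlation inequalities for `φ_{w,q}`, every `q > 0` — file 28a: `C_∞(and_S)` FOR THE 3-EDGE PATH `S = P₄` ACROSS A PARALLEL
# JUNCTION — the contracted side input from Theorem U and the assembled theorem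

Support file (`--supports stmt-CriticalPhenomena-4575`), FK sub-lane `prim-bschramm-fk-2` (gen 19) of the post-continuity programme; builds
on p205010 (kernel theorem, internal audit signed; external expert review pending).  No definitions, no named facts, no sorries; standard axioms.

`…AntipodalAnd4Parallel.lean` proved the abstract parallel-junction theorem `FK.and4_parallel_nonpos`: the AND-drift
`∑_{γ ⊆ N} (q^{k(γ∪S)+k(N\γ)} - q^{k((N\γ)∪S)+k(γ)}) g(γ)` of `S = {ab, bc, cd}` on a two-point union `N = N₁ ⊔_{b,c} N₂` is `≤ 0`
(`0 < q ≤ 1`) as soon as, on each side, the |W| = 3 AND-drift (`(a,b,c)`, resp. `(d,c,b)`) is `≤ 0` and the `bc`-contracted Theorem-U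
functional (`apUpcC q N₁ {bc} a b`, resp. `apUpcC q N₂ {bc} c d`) is `≥ 0` on monotone test functions.  This file supplies:
* `FK.xi_side_nonneg` — the contracted side input for a two-terminal series–parallel `E` between `s, t` with `st ∉ E`, `uv ∈ E`,
  `N = E \ {uv}`: `0 ≤ apUpcC q N {st} u v h` for every `h` monotone on the subsets of `N` (`q > 0`) — gen 11's
  `apUpcC_nonneg_of_isTTSP` for the network `E ∪ {st}` re-rooted at `uv` (`IsTTSP.reroot`), free set `N`, contracted set `{st}`;
* **`FK.apPsi_and_path3_parallel_nonpos`** — for `A₁ = N₁ ∪ {ab}` and `A₂ = N₂ ∪ {cd}` both TTSP between `b, c`, edge-disjoint, with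
  spanned vertex sets meeting only inside `{b, c}`, neither containing `bc`, and `H = A₁ ∪ A₂ ∪ {bc}`:
  `apPsi q H 1_{{ab,bc,cd} ⊆ ·} g ≤ 0` for every `0 < q ≤ 1` and every increasing `g` on `N₁ ∪ N₂` not reading `ab, bc, cd` — gen 10's
  Conjecture `C_∞` for the AND type on a 3-edge PATH whose middle-edge complement `H \ bc = A₁ ∥ A₂` is a PARALLEL composition with the
  end edges in different children; with file 27a (series root) this leaves, for `S = P₄` inside a 2-connected series–parallel graph, only
  the case of a parallel root with both end edges in ONE series child ("theta" junction, memo `bschramm/FROM-fk-2-g18-AND-WORDHALL.md` §7A).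
  Equivalently: every square-free coefficient of `Z_H² Cov_{φ_{z,q}}(ω_{ab} ω_{bc} ω_{cd}, g)` is `≤ 0` there.
[cite: Grimmett2006, §1.4 eq. (1.20) (p. 15); §3.8 Thm. (3.90) (pp. 61–62); §3.9 (pp. 63–64)] [cite: Wagner2006, Thm. 5.8(d), §5.3]
-/

noncomputable section

namespace Summit.CriticalPhenomena.PercolationContinuityZ3.Theorems

namespace FK

open SimpleGraph Literature.Probability.LatticeModels Literature.Probability.Percolation
open scoped Classical

variable {V : Type*} [Fintype V]

/-! ### The contracted side input -/

section Sides

variable {s t u v : V}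

/-- **Side input Ξ (the contracted single-edge drift of a side).**  `E` TTSP between `s, t`, `st ∉ E`, `uv ∈ E`, `N = E \ {uv}`: for every
`h` monotone on the subsets of `N` and every `q > 0`, `0 ≤ apUpcC q N {st} u v h =
∑_{γ ⊆ N} q^{k(γ∪st)+k((N\γ)∪st)} (1{u ↔ v in γ ∪ st} - 1{u ↔ v in (N\γ) ∪ st}) h(γ)` — Theorem U with a contracted set
(`apUpcC_nonneg_of_isTTSP`) for the network `E ∪ {st}` re-rooted at `uv` (`IsTTSP.reroot`).
[cite: Grimmett2006, §3.8 Thm. (3.90) (pp. 61–62); §3.9 (pp. 63–64)] [cite: Wagner2006, Thm. 5.8(d), §5.3] -/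
theorem xi_side_nonneg {q : ℝ} (hq0 : 0 < q) {E : Finset (Sym2 V)} (hE : IsTTSP E s t) (hst : s(s, t) ∉ E)
    (huv : s(u, v) ∈ E) {h : Finset (Sym2 V) → ℝ}
    (hmono : ∀ ⦃A B : Finset (Sym2 V)⦄, A ⊆ B → B ⊆ E.erase s(u, v) → h A ≤ h B) :
    0 ≤ apUpcC q (E.erase s(u, v)) {s(s, t)} u v h := by
  -- re-root `E ∪ {st}` at `uv`
  have hR : IsTTSP (E ∪ {s(s, t)}) u v :=
    hE.reroot (IsTTSP.edge hE.ne) (Finset.disjoint_singleton_right.2 hst) (fun z _ hz => by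
      obtain ⟨e, he, hze⟩ := hz
      rw [Finset.mem_singleton] at he; subst he
      exact Sym2.mem_iff.1 hze) huv
  have hNR : E.erase s(u, v) ⊆ E ∪ {s(s, t)} := (Finset.erase_subset _ _).trans Finset.subset_union_left
  have hCR : ({s(s, t)} : Finset (Sym2 V)) ⊆ E ∪ {s(s, t)} := Finset.subset_union_right
  exact apUpcC_nonneg_of_isTTSP hq0 hR (E.erase s(u, v)) {s(s, t)} hNR hCR h hmono

end Sides

/-! ### `C_∞(and_S)` for the 3-edge path across a parallel junction -/

section Main

variable {a b c d : V}

/-- **THEOREM (`C_∞` at level 3 for `S = P₄`, parallel junction).**  Let `A₁ = N₁ ∪ {ab}` and `A₂ = N₂ ∪ {cd}` be two-terminal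
series–parallel networks between `b` and `c`, edge-disjoint, with spanned vertex sets meeting only inside `{b, c}`, neither containing the
middle edge `bc`.  Then for `H = A₁ ∪ A₂ ∪ {bc}` — a 2-connected series–parallel graph whose `H \ bc` is the PARALLEL composition `A₁ ∥ A₂`,
the end edges `ab`, `cd` lying in different children — the path `S = {ab, bc, cd} ⊆ H`, every `0 < q ≤ 1` and every increasing `g` not
reading `S`: `apPsi q H 1_{S ⊆ ·} g ≤ 0`, i.e. every square-free coefficient of `Z_H² Cov_{φ_{z,q}}(ω_{ab} ω_{bc} ω_{cd}, g)` is `≤ 0` —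
gen 10's Conjecture `C_∞` for the AND type on three edges forming a path, in the parallel case.  Proof: `apPsi_andInd_eq` +
`and4_parallel_nonpos`, the side inputs being gen 11's |W| = 3 theorem (`and2_side_nonpos`) and Theorem U with the middle edge contracted
(`xi_side_nonneg`). [cite: Grimmett2006, §3.8 Thm. (3.90) (pp. 61–62); §3.9 (pp. 63–64)] [cite: Wagner2006, Thm. 5.8(d), §5.3] -/
theorem apPsi_and_path3_parallel_nonpos {q : ℝ} (hq0 : 0 < q) (hq1 : q ≤ 1) {N₁ N₂ : Finset (Sym2 V)}
    (hA₁ : IsTTSP (insert s(a, b) N₁) b c) (hA₂ : IsTTSP (insert s(c, d) N₂) b c) (habN : s(a, b) ∉ N₁) (hcdN : s(c, d) ∉ N₂)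
    (hd : Disjoint (insert s(a, b) N₁) (insert s(c, d) N₂))
    (hV : ∀ z : V, (∃ e ∈ insert s(a, b) N₁, z ∈ e) → (∃ e ∈ insert s(c, d) N₂, z ∈ e) → z = b ∨ z = c)
    (hbc₁ : s(b, c) ∉ insert s(a, b) N₁) (hbc₂ : s(b, c) ∉ insert s(c, d) N₂)
    {g : Finset (Sym2 V) → ℝ} (hg : ∀ A T : Finset (Sym2 V), T ⊆ {s(a, b), s(b, c), s(c, d)} → g (A ∪ T) = g A)
    (hmono : ∀ ⦃A B : Finset (Sym2 V)⦄, A ⊆ B → B ⊆ N₁ ∪ N₂ → g A ≤ g B) :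
    apPsi q (insert s(b, c) (insert s(a, b) N₁ ∪ insert s(c, d) N₂))
      (fun X => if ({s(a, b), s(b, c), s(c, d)} : Finset (Sym2 V)) ⊆ X then 1 else 0) g ≤ 0 := by
  have hbc : b ≠ c := hA₁.ne
  -- vertex sets of the sides
  set V₁ : Set V := {z | ∃ e ∈ insert s(a, b) N₁, z ∈ e} with hV₁
  set V₂ : Set V := {z | ∃ e ∈ insert s(c, d) N₂, z ∈ e} with hV₂
  have h₁ : ∀ e ∈ (↑(insert s(a, b) N₁) : Set (Sym2 V)), ∀ z ∈ e, z ∈ V₁ := fun e he z hz => ⟨e, he, hz⟩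
  have h₂ : ∀ e ∈ (↑(insert s(c, d) N₂) : Set (Sym2 V)), ∀ z ∈ e, z ∈ V₂ := fun e he z hz => ⟨e, he, hz⟩
  have hS : V₁ ∩ V₂ ⊆ ({b, c} : Set V) := by
    intro z hz
    rcases hV z hz.1 hz.2 with h | h
    · exact Or.inl h
    · exact Or.inr h
  have hdN : Disjoint N₁ N₂ :=
    Finset.disjoint_of_subset_left (Finset.subset_insert _ _) (Finset.disjoint_of_subset_right (Finset.subset_insert _ _) hd)
  -- `S` is disjoint from `N = N₁ ⊔ N₂`
  have hNS : Disjoint (N₁ ∪ N₂) ({s(a, b), s(b, c), s(c, d)} : Finset (Sym2 V)) := by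
    refine Finset.disjoint_left.2 fun e he heS => ?_
    simp only [Finset.mem_insert, Finset.mem_singleton] at heS
    rcases Finset.mem_union.1 he with h | h
    · rcases heS with rfl | rfl | rfl
      · exact habN h
      · exact hbc₁ (Finset.mem_insert_of_mem h)
      · exact Finset.disjoint_left.1 hd (Finset.mem_insert_of_mem h) (Finset.mem_insert_self _ _)
    · rcases heS with rfl | rfl | rfl
      · exact Finset.disjoint_left.1 hd (Finset.mem_insert_self _ _) (Finset.mem_insert_of_mem h)
      · exact hbc₂ (Finset.mem_insert_of_mem h)
      · exact hcdN h
  rw [← union_path3_eq N₁ N₂ a b c d, apPsi_andInd_eq q hNS ⟨s(a, b), Finset.mem_insert_self _ _⟩ hg]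
  -- the four side inputs
  have hY₁ : ∀ h' : Finset (Sym2 V) → ℝ, (∀ ⦃A B : Finset (Sym2 V)⦄, A ⊆ B → B ⊆ N₁ → h' A ≤ h' B) →
      ∑ γ₁ ∈ N₁.powerset, (q ^ (clusterCount (↑(insert s(b, c) (insert s(a, b) γ₁)) : BondConfig V) ∅ +
          clusterCount (↑(N₁ \ γ₁) : BondConfig V) ∅) -
        q ^ (clusterCount (↑(insert s(b, c) (insert s(a, b) (N₁ \ γ₁))) : BondConfig V) ∅ +
          clusterCount (↑γ₁ : BondConfig V) ∅)) * h' γ₁ ≤ 0 := by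
    intro h' hm
    have key := and2_side_nonpos hq0 hq1 hA₁ hbc₁ (Finset.mem_insert_self _ _) (h := h')
      (by rw [Finset.erase_insert habN]; exact hm)
    rwa [Finset.erase_insert habN] at key
  have hΞ₁ : ∀ h' : Finset (Sym2 V) → ℝ, (∀ ⦃A B : Finset (Sym2 V)⦄, A ⊆ B → B ⊆ N₁ → h' A ≤ h' B) →
      0 ≤ apUpcC q N₁ {s(b, c)} a b h' := by
    intro h' hm
    have key := xi_side_nonneg hq0 hA₁ hbc₁ (Finset.mem_insert_self _ _) (h := h')
      (by rw [Finset.erase_insert habN]; exact hm)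
    rwa [Finset.erase_insert habN] at key
  have hY₂ : ∀ h' : Finset (Sym2 V) → ℝ, (∀ ⦃A B : Finset (Sym2 V)⦄, A ⊆ B → B ⊆ N₂ → h' A ≤ h' B) →
      ∑ γ₂ ∈ N₂.powerset, (q ^ (clusterCount (↑(insert s(b, c) (insert s(c, d) γ₂)) : BondConfig V) ∅ +
          clusterCount (↑(N₂ \ γ₂) : BondConfig V) ∅) -
        q ^ (clusterCount (↑(insert s(b, c) (insert s(c, d) (N₂ \ γ₂))) : BondConfig V) ∅ +
          clusterCount (↑γ₂ : BondConfig V) ∅)) * h' γ₂ ≤ 0 := by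
    intro h' hm
    have key := and2_side_nonpos hq0 hq1 hA₂ hbc₂ (Finset.mem_insert_self _ _) (h := h')
      (by rw [Finset.erase_insert hcdN]; exact hm)
    rwa [Finset.erase_insert hcdN] at key
  have hΞ₂ : ∀ h' : Finset (Sym2 V) → ℝ, (∀ ⦃A B : Finset (Sym2 V)⦄, A ⊆ B → B ⊆ N₂ → h' A ≤ h' B) →
      0 ≤ apUpcC q N₂ {s(b, c)} c d h' := by
    intro h' hm
    have key := xi_side_nonneg hq0 hA₂ hbc₂ (Finset.mem_insert_self _ _) (h := h')
      (by rw [Finset.erase_insert hcdN]; exact hm)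
    rwa [Finset.erase_insert hcdN] at key
  have main := and4_parallel_nonpos hq0 hq1 h₁ h₂ hS hbc (Finset.mem_insert_self _ _) (Finset.mem_insert_self _ _)
    hdN (Finset.subset_insert _ _) (Finset.subset_insert _ _) hY₁ hΞ₁ hY₂ hΞ₂ hmono
  linarith

end Main

end FK

end Summit.CriticalPhenomena.PercolationContinuityZ3.Theorems

end
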